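import Mathlib
import Summits.KontsevichZagierPeriods.KontsevichZagierPeriods.Theorems.SoloInformedZetaTwoTwoSum
import Literature.NumberTheory.Transcendental.MZVSimplexRepProofs
import Literature.NumberTheory.Transcendental.MultipleZetaDepthTwoProofs
import Literature.NumberTheory.Transcendental.MultipleZetaHoffmanRelationProofs
import Literature.NumberTheory.Transcendental.MultipleZetaValuesWeightFourProofs
import HarnessLib
import HarnessLib.Audit

/-!
# SoloInformed — the Kontsevich–Zagier period conjecture holds on the weight-4 MZV sector

Solo programme `solo-KontsevichZagierPeriods-informed`, session s45 (PART XVI, THEOREM XXXVI).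

The summit statement asks: equal values ⇒ equivalent under the three rules. Here it is DECIDED,
unconditionally and over `ℤ`, on the subgroup of `KZ.FormalRep` spanned by Kontsevich's simplex
representations `Z(4), Z(3,1), Z(2,2), Z(2,1,1)` of the weight-4 multiple zeta values:

* `soloInformed_mzvRep4_class` — every weight-4 admissible `Z(s)` is `≡ n(s)·Z(3,1)` modulo
  `KZ.relations` with `ζ(s) = n(s)·π⁴/360` (`n = 4, 1, 3, 4`), by the telescope relations
  (`SoloInformedZetaFourSum`, `SoloInformedZetaTwoTwoSum`) and the duality reflection
  (`SoloInformedZetaFourDual`), the values being the Literature's `multipleZeta_four`,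
  `multipleZeta_three_one`, `multipleZeta_two_two`, `multipleZeta_two_one_one`;
* `soloInformed_kzp_mzvRep_weight4` — for admissible `s, s'` of weight `4`:
  `Z(s).value = Z(s').value → KZ.Equivalent Z(s) Z(s')`;
* `soloInformed_kzp_weight4_span` — for all `a b c d : ℤ`:
  `eval (a·[Z(4)] + b·[Z(3,1)] + c·[Z(2,2)] + d·[Z(2,1,1)]) = 0 ↔ (that element) ∈ KZ.relations`,
  i.e. `ker (eval) = relations` on this rank-4 subgroup (the kernel form `KZPeriodConjecture'`
  restricted to it).
-/

noncomputable section

open MeasureTheory Set MvPolynomial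
open Literature.ModelTheory.ExponentialFields Literature.NumberTheory.Transcendental
open Literature.NumberTheory.Transcendental.KZ

namespace Summit.KontsevichZagierPeriods.KontsevichZagierPeriods.Theorems

/-! ## 1. Values and classes of the four representations -/

/-- `Z(4).value = π⁴/90`. -/
theorem soloInformedZ4_value : soloInformedZ4.value = Real.pi ^ 4 / 90 := by
  rw [← multipleZeta_four]; exact mzvRep_value_holds [4] _ _ _

/-- `Z(3,1).value = π⁴/360`. -/
theorem soloInformedZ31_value : soloInformedZ31.value = Real.pi ^ 4 / 360 := by
  rw [← multipleZeta_three_one]; exact mzvRep_value_holds [3, 1] _ _ _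

/-- `Z(2,2).value = π⁴/120`. -/
theorem soloInformedZ22_value : soloInformedZ22.value = Real.pi ^ 4 / 120 := by
  rw [← multipleZeta_two_two]; exact mzvRep_value_holds [2, 2] _ _ _

/-- `Z(2,1,1).value = π⁴/90`. -/
theorem soloInformedZ211_value : soloInformedZ211.value = Real.pi ^ 4 / 90 := by
  rw [← multipleZeta_two_one_one]; exact mzvRep_value_holds [2, 1, 1] _ _ _

/-- `[Z(4)] − 4·[Z(3,1)] ∈ relations`. -/
theorem soloInformed_Z4_sub_four_Z31 : of soloInformedZ4 - 4 • of soloInformedZ31 ∈ relations := by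
  have h := relations.neg_mem soloInformed_fds4_mem_relations
  rwa [neg_sub] at h

/-- `[Z(2,2)] − 3·[Z(3,1)] ∈ relations`. -/
theorem soloInformed_Z22_sub_three_Z31 : of soloInformedZ22 - 3 • of soloInformedZ31 ∈ relations := by
  have h : of soloInformedZ22 - 3 • of soloInformedZ31 = (of soloInformedZ31 + of soloInformedZ22
      - of soloInformedZ4) - (4 • of soloInformedZ31 - of soloInformedZ4) := by abel
  rw [h]
  exact relations.sub_mem soloInformed_sumFormula4_mem_relations soloInformed_fds4_mem_relations

/-- `[Z(2,1,1)] − 4·[Z(3,1)] ∈ relations`. -/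
theorem soloInformed_Z211_sub_four_Z31 : of soloInformedZ211 - 4 • of soloInformedZ31 ∈ relations := by
  have h : of soloInformedZ211 - 4 • of soloInformedZ31
      = -(of soloInformedZ4 - of soloInformedZ211) - (4 • of soloInformedZ31 - of soloInformedZ4) := by
    abel
  rw [h]
  exact relations.sub_mem (relations.neg_mem soloInformed_Z4_sub_Z211) soloInformed_fds4_mem_relations

/-- **Every weight-4 admissible simplex representation is `≡ n·Z(3,1)` with `ζ(s) = n·π⁴/360`.** -/
theorem soloInformed_mzvRep4_class (s : List ℕ) (hs : MZV.IsAdmissible s) (hw : MZV.weight s = 4)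
    (h₁ : IsSemialgebraicFunOn ℚ (openOrderedSimplex (MZV.weight s)) (mzvIntegrand s))
    (h₂ : IntegrableOn (mzvIntegrand s) (openOrderedSimplex (MZV.weight s)) volume) :
    ∃ n : ℕ, of (mzvRep s hs h₁ h₂) - n • of soloInformedZ31 ∈ relations ∧
      (mzvRep s hs h₁ h₂).value = n * (Real.pi ^ 4 / 360) := by
  rw [mzvRep_value_holds s hs h₁ h₂]
  rcases MZV.eq_of_isAdmissible_of_weight_eq_four hs hw with rfl | rfl | rfl | rfl
  · have e : mzvRep [4] hs h₁ h₂ = soloInformedZ4 := rfl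
    refine ⟨4, by rw [e]; exact soloInformed_Z4_sub_four_Z31, ?_⟩
    rw [multipleZeta_four]; push_cast; ring
  · have e : of (mzvRep [3, 1] hs h₁ h₂) - 1 • of soloInformedZ31 = 0 := by
      rw [one_smul]; exact sub_self _
    refine ⟨1, by rw [e]; exact relations.zero_mem, ?_⟩
    rw [multipleZeta_three_one]; push_cast; ring
  · have e : mzvRep [2, 2] hs h₁ h₂ = soloInformedZ22 := rfl
    refine ⟨3, by rw [e]; exact soloInformed_Z22_sub_three_Z31, ?_⟩
    rw [multipleZeta_two_two]; push_cast; ring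
  · have e : mzvRep [2, 1, 1] hs h₁ h₂ = soloInformedZ211 := rfl
    refine ⟨4, by rw [e]; exact soloInformed_Z211_sub_four_Z31, ?_⟩
    rw [multipleZeta_two_one_one]; push_cast; ring

/-! ## 2. The period conjecture on the weight-4 MZV sector -/

/-- **THEOREM XXXVI (KZ period conjecture for the weight-4 simplex representations).**
For admissible `s, s'` of weight `4`: equal values ⇒ equivalent under the three rules. -/
theorem soloInformed_kzp_mzvRep_weight4 (s s' : List ℕ) (hs : MZV.IsAdmissible s)
    (hs' : MZV.IsAdmissible s') (hw : MZV.weight s = 4) (hw' : MZV.weight s' = 4)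
    (h₁ : IsSemialgebraicFunOn ℚ (openOrderedSimplex (MZV.weight s)) (mzvIntegrand s))
    (h₂ : IntegrableOn (mzvIntegrand s) (openOrderedSimplex (MZV.weight s)) volume)
    (h₁' : IsSemialgebraicFunOn ℚ (openOrderedSimplex (MZV.weight s')) (mzvIntegrand s'))
    (h₂' : IntegrableOn (mzvIntegrand s') (openOrderedSimplex (MZV.weight s')) volume)
    (h : (mzvRep s hs h₁ h₂).value = (mzvRep s' hs' h₁' h₂').value) :
    Equivalent (mzvRep s hs h₁ h₂) (mzvRep s' hs' h₁' h₂') := by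
  obtain ⟨n, hn, hv⟩ := soloInformed_mzvRep4_class s hs hw h₁ h₂
  obtain ⟨n', hn', hv'⟩ := soloInformed_mzvRep4_class s' hs' hw' h₁' h₂'
  rw [hv, hv'] at h
  have hpi : (0 : ℝ) < Real.pi ^ 4 / 360 := by positivity
  have hnn : (n : ℝ) = n' := mul_right_cancel₀ hpi.ne' h
  have e : n = n' := by exact_mod_cast hnn
  subst e
  have hsplit : of (mzvRep s hs h₁ h₂) - of (mzvRep s' hs' h₁' h₂')
      = (of (mzvRep s hs h₁ h₂) - n • of soloInformedZ31)
        - (of (mzvRep s' hs' h₁' h₂') - n • of soloInformedZ31) := by abel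
  rw [Equivalent, hsplit]
  exact relations.sub_mem hn hn'

/-- **THEOREM XXXVI′ (kernel form on the span).** On the subgroup of `FormalRep` spanned by
`[Z(4)], [Z(3,1)], [Z(2,2)], [Z(2,1,1)]`, the kernel of `KZ.eval` is exactly `KZ.relations`. -/
theorem soloInformed_kzp_weight4_span (a b c d : ℤ) :
    eval (a • of soloInformedZ4 + b • of soloInformedZ31 + c • of soloInformedZ22 + d • of soloInformedZ211)
      = 0 ↔
    a • of soloInformedZ4 + b • of soloInformedZ31 + c • of soloInformedZ22 + d • of soloInformedZ211
      ∈ relations := by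
  constructor
  · intro h
    simp only [map_add, map_zsmul, eval_of, soloInformedZ4_value, soloInformedZ31_value,
      soloInformedZ22_value, soloInformedZ211_value, zsmul_eq_mul] at h
    have hpi : (0 : ℝ) < Real.pi ^ 4 := by positivity
    have hmul : ((4 * a + b + 3 * c + 4 * d : ℤ) : ℝ) * Real.pi ^ 4 = 0 := by
      push_cast; linear_combination 360 * h
    have hz : 4 * a + b + 3 * c + 4 * d = 0 := by
      exact_mod_cast (mul_eq_zero.1 hmul).resolve_right hpi.ne'
    have e : a • of soloInformedZ4 + b • of soloInformedZ31 + c • of soloInformedZ22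
          + d • of soloInformedZ211
        = a • (of soloInformedZ4 - 4 • of soloInformedZ31) + c • (of soloInformedZ22 - 3 • of soloInformedZ31)
          + d • (of soloInformedZ211 - 4 • of soloInformedZ31)
          + (4 * a + b + 3 * c + 4 * d) • of soloInformedZ31 := by
      module
    rw [e, hz, zero_smul, add_zero]
    exact relations.add_mem (relations.add_mem (relations.zsmul_mem soloInformed_Z4_sub_four_Z31 a)
      (relations.zsmul_mem soloInformed_Z22_sub_three_Z31 c))
      (relations.zsmul_mem soloInformed_Z211_sub_four_Z31 d)
  · intro h
    exact (AddMonoidHom.mem_ker).1 (relations_le_ker_eval_holds h)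

end Summit.KontsevichZagierPeriods.KontsevichZagierPeriods.Theorems
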